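import Summits.CriticalPhenomena.PercolationContinuityZ3.Theorems.PercNearOneGluingNoHeavyLowerTailKnQuestion8AntitheticCrownUniversal
import Summits.CriticalPhenomena.PercolationContinuityZ3.Theorems.PercNearOneGluingNoHeavyLowerTailKnQuestion8AntitheticCrownBridge
import Summits.CriticalPhenomena.PercolationContinuityZ3.Theorems.PercNearOneGluingNoHeavyLowerTailKnQuestion8AntitheticVirtualCrownTools
import HarnessLib

/-!
# `NoHeavyLowerTail` (crux stmt-CriticalPhenomena-4575), antithetic vdBHK programme: the VIRTUAL CROWN LEMMA — THEOREM CO with the third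
# crown top replaced by a VIRTUAL element (a monotone ι-equivariant section), the engine of THEOREM COβ (β-cycles of every length obstruct AK)

Support file (seat `prim-ineq-gen-7` gen 48; `--supports stmt-CriticalPhenomena-4575`).  No `sorry`, no definitions.
Memo / pencil proof: run/shared/lean/prim/prim-ineq-gen-7/PROOF-COBETA-g48.md §4 ('virtual crown lemma'), FINDING-COBETA-g48.md.

SETTING exactly as in `…AntitheticCrownObstruction` (g47): `E` a finite partial order, `down`/`hdown` strict down-sets, `lab`/`hlab` the Λ-labels
(`0 = RI, 1 = RN, 2 = BN, 3 = BI`) of colourings `s : E → Bool` (`true` = red), `leL` the order of `Λ = {RI, BN} < {RN, BI}`, `le`/`hle` the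
labelwise colouring order `Ω_P` (= the programme's explicit order, `AntitheticColouringOrder.label_order_iff`), `ι` = complementation.
Crown data: minimal `a, b, c`, a top `x > a, b` (`x ≯ c`) and a top `z > b, c` (`z ≯ a`).  Instead of a third top `y > a, c` (`y ≯ b`) we are given a
VIRTUAL top: a non-empty set `S` of elements (disjoint from `a, c` and from `↓x`, `↓z`), a set `D ⊇ S ∪ {a, c}` avoiding `b, x, z` ('`↓°y`'), and
a colour function `cy` of colourings that depends only on the colours on `S`, is self-dual (`cy ∘ ι = ! cy`) and is red on 'S all red'; the virtual
label `ly s` is `RI` if `cy s` and all of `D` is red, `RN` if `cy s` otherwise, `BI` / `BN` symmetrically.  HYPOTHESIS: `ly` is monotone along `Ω_P`.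
* `AntitheticVirtualCrown.virtual_crown_obstruction` — then `Ω_P` is NOT antipodal Kleitman: there are `le`-up-sets `U, H` with `#(U ∩ H) < #(U ∩ ιH)`.
With `S = {y}`, `D = ↓y`, `cy s = s y` this is THEOREM CO itself; with `S` = the path `x_2, a_3, x_3, …, a_{k-1}, x_{k-1}` of a β-k-cycle, `D = ↓x_2 ∪ … ∪ ↓x_{k-1}`
and `cy` = 'colour of the first path top whose colour differs from the atom to its right' it gives THEOREM COβ (file `…AntitheticBetaCycleObstruction`).
PROOF.  `U, H` = pull-backs of the universal crown certificate along `s ↦ (lab a, lab b, lab c, lab x, ly, lab z)` (base-4 code, `y`-slot virtual); up-sets by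
monotonicity; `#(U∩H) − #(U∩ιH) = Σ_s G(κ s, ρ s)` as in g47; the `S`-dependent junk pattern of the virtual top is replaced by a fibre-constant one with the same
code (`ρ̂`), fibres are normalised on `S` (`AntitheticVirtualCrownTools.fibre_sum`), and complementing OFF the five and `S` pairs patterns with their swaps, so that
`dtilde_nonpos` / `dtilde_strict` give `2Δ ≤ −1`.
-/

namespace Summit.CriticalPhenomena.PercolationContinuityZ3.Theorems

open Finset

namespace AntitheticVirtualCrown

variable {E : Type*} [Fintype E] [DecidableEq E] [PartialOrder E]

/-- **VIRTUAL CROWN LEMMA.**  Finite poset, Λ-labels and colouring order as in `AntitheticCrownObstruction.crown_obstruction`; minimal `a, b, c`,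
`x > a, b` (`x ≯ c`), `z > b, c` (`z ≯ a`); a virtual third top over `a, c`: `S` non-empty, `a, c ∉ S`, no element of `S` below `x` or `z`;
`S ⊆ D`, `a, c ∈ D`, `b, x, z ∉ D`; `cy` depends only on the colours on `S`, `cy (ι s) = ! cy s`, `cy` = red when `S` is all red; `ly s ∈ {0,1,2,3}` the
virtual label (`RI` iff `cy s` and `D` all red, `BI` iff `! cy s` and `D` all blue, else `RN`/`BN` by `cy`).  If `ly` is monotone along the colouring
order then there are up-sets `U, H` with `#(U ∩ H) < #(U ∩ ιH)` — `Ω_P` is not antipodal Kleitman. [this work: PROOF-COBETA-g48.md §4] -/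
theorem virtual_crown_obstruction
    (down : E → Finset E) (hdown : ∀ d e, d ∈ down e ↔ d < e)
    (lab : (E → Bool) → E → ℕ)
    (hlab : ∀ s e, lab s e = if s e = true then (if ∀ d ∈ down e, s d = true then 0 else 1)
      else (if ∀ d ∈ down e, s d = false then 3 else 2))
    (leL : ℕ → ℕ → Bool)
    (hleL : leL = fun p q => p == q || (p == 0 && q == 1) || (p == 0 && q == 3) || (p == 2 && q == 1) || (p == 2 && q == 3))
    (le : (E → Bool) → (E → Bool) → Prop) (hle : ∀ s t, le s t ↔ ∀ e, leL (lab s e) (lab t e) = true)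
    (a b c x z : E) (ha : ∀ d, ¬ d < a) (hb : ∀ d, ¬ d < b) (hc : ∀ d, ¬ d < c)
    (hax : a < x) (hbx : b < x) (hcx : ¬ c < x) (hbz : b < z) (hcz : c < z) (haz : ¬ a < z)
    (S D : Finset E) (cy : (E → Bool) → Bool) (ly : (E → Bool) → ℕ)
    (hSne : S.Nonempty) (haS : a ∉ S) (hcS : c ∉ S) (hSx : ∀ d ∈ S, ¬ d < x) (hSz : ∀ d ∈ S, ¬ d < z)
    (hSD : S ⊆ D) (haD : a ∈ D) (hcD : c ∈ D) (hbD : b ∉ D) (hxD : x ∉ D) (hzD : z ∉ D)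
    (hcyS : ∀ s t : E → Bool, (∀ e ∈ S, s e = t e) → cy s = cy t)
    (hcyc : ∀ s : E → Bool, cy (fun e => !s e) = !cy s)
    (hcyr : ∀ s : E → Bool, (∀ e ∈ S, s e = true) → cy s = true)
    (hly : ∀ s, ly s = if cy s = true then (if ∀ d ∈ D, s d = true then 0 else 1) else (if ∀ d ∈ D, s d = false then 3 else 2))
    (hmono : ∀ s t, le s t → leL (ly s) (ly t) = true) :
    ∃ U H : Finset (E → Bool), (∀ s t, le s t → s ∈ U → t ∈ U) ∧ (∀ s t, le s t → s ∈ H → t ∈ H) ∧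
      (U ∩ H).card < (U ∩ H.image (fun s => fun e => !s e)).card := by
  classical
  -- ### the finite data of the certificate (verbatim from `AntitheticCrownObstruction`)
  set enc6 : Bool → Bool → Bool → Bool → Bool → Bool → ℕ := fun p0 p1 p2 p3 p4 p5 => (if p0 then 1 else 0) + (if p1 then 2 else 0) +
    (if p2 then 4 else 0) + (if p3 then 8 else 0) + (if p4 then 16 else 0) + (if p5 then 32 else 0) with henc
  set labC : Bool → Bool → Bool → Bool → Bool → ℕ := fun own p q rj bj => if own then (if p && q && rj then 0 else 1)
    else (if !p && !q && bj then 3 else 2) with hlabC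
  set τ : ℕ → ℕ → ℕ := fun κ ρ =>
      (if κ.testBit 0 then 0 else 3) + 4 * (if κ.testBit 1 then 0 else 3) + 16 * (if κ.testBit 2 then 0 else 3) +
      64 * labC (κ.testBit 3) (κ.testBit 0) (κ.testBit 1) (ρ.testBit 0) (ρ.testBit 1) +
      256 * labC (κ.testBit 4) (κ.testBit 0) (κ.testBit 2) (ρ.testBit 2) (ρ.testBit 3) +
      1024 * labC (κ.testBit 5) (κ.testBit 1) (κ.testBit 2) (ρ.testBit 4) (ρ.testBit 5) with hτ
  set sw : ℕ → ℕ := fun ρ => ((ρ &&& 21) <<< 1) ||| ((ρ &&& 42) >>> 1) with hsw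
  set le6 : ℕ → ℕ → Bool := fun m t => (List.range 6).all fun i => leL ((m >>> (2 * i)) &&& 3) ((t >>> (2 * i)) &&& 3) with hle6
  set fU : ℕ → Bool := fun t => [128, 2432, 1664, 2188, 643, 2767].any fun m => le6 m t with hfU
  set gH : ℕ → Bool := fun t => [2624, 2608, 3772, 2995].any fun m => le6 m t with hgH
  set ft : ℕ → Bool := fun t => ([0, 12734772374285299899, 12734772374285299899, 12734772374285299899, 0, 12734772374285299899, 12734772374285299899, 12734772374285299899, 0, 
        9261652635843854472, 9261652635843854472, 9261652635843854472, 0, 12734772374285299899, 12734772374285299899, 12734772374285299899, 0, 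
        12734772374285299899, 12734772374285299899, 12734772374285299899, 0, 12734772374285299899, 12734772374285299899, 12734772374285299899, 0, 
        12734772374285299899, 12734772374285299899, 12734772374285299899, 0, 12734772374285299899, 12734772374285299899, 12734772374285299899, 0, 
        12682136553628151808, 12682136553628151808, 12682136553628151808, 0, 12734772374285299899, 12734772374285299899, 12734772374285299899, 0, 0, 0, 
        9223372039002292224, 0, 12682136553628151808, 12682136553628151808, 12682136553628151808, 0, 12734772374285299899, 12734772374285299899, 
        12734772374285299899, 0, 12734772374285299899, 12734772374285299899, 12734772374285299899, 0, 9261652635843854472, 9261652635843854472, 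
        9261652635843854472, 0, 12734772374285299899, 12734772374285299899, 12734772374285299899].getD (t / 64) 0).testBit (t % 64) with hft
  set gt : ℕ → Bool := fun t => ([0, 0, 0, 0, 0, 0, 0, 0, 0, 0, 0, 0, 0, 0, 0, 0, 0, 0, 0, 0, 12734772371320209408, 12734772374285299899, 0, 12734772371320209408, 
        12734772371320209408, 12734772374285299899, 0, 12734772371320209408, 12734772371320209408, 12734772374285299899, 9261652633687425024, 
        12734772371320209408, 0, 0, 0, 0, 12734772371320209408, 12734772374285299899, 0, 12734772371320209408, 12734772371320209408, 12734772374285299899, 0, 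
        12734772371320209408, 12734772371320209408, 12734772374285299899, 9261652633687425024, 12734772371320209408, 0, 0, 0, 0, 12734772371320209408, 
        12734772374285299899, 12682136550675316736, 12734772371320209408, 12734772371320209408, 12734772374285299899, 12682136550675316736, 
        12734772371320209408, 12734772371320209408, 12734772374285299899, 12720417147507965952, 12734772371320209408].getD (t / 64) 0).testBit (t % 64) with hgt
  set Dc : ℕ → ℤ := fun ρ => ((List.range 64).map fun κ =>
      if ft (τ κ ρ) then ((if gt (τ κ ρ) then (1 : ℤ) else 0) - (if gt (4095 - τ κ ρ) then (1 : ℤ) else 0)) else 0).sum with hDc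
  have htabf := AntitheticCrownUniversal.table_f leL hleL le6 hle6 fU hfU ft hft
  have htabg := AntitheticCrownUniversal.table_g leL hleL le6 hle6 gH hgH gt hgt
  have hnonpos := AntitheticCrownUniversal.dtilde_nonpos ft hft gt hgt labC hlabC τ hτ Dc hDc sw hsw
  have hstrict := AntitheticCrownUniversal.dtilde_strict ft hft gt hgt labC hlabC τ hτ Dc hDc sw hsw
  -- ### distinctness
  have hab : a ≠ b := fun h => haz (h ▸ hbz); have hac : a ≠ c := fun h => hcx (h ▸ hax); have hbc : b ≠ c := fun h => hbD (h ▸ hcD)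
  have hxa : x ≠ a := fun h => lt_irrefl a (h ▸ hax); have hxb : x ≠ b := fun h => lt_irrefl b (h ▸ hbx)
  have hxc : x ≠ c := fun h => hc a (h ▸ hax)
  have hza : z ≠ a := fun h => ha b (h ▸ hbz); have hzb : z ≠ b := fun h => lt_irrefl b (h ▸ hbz)
  have hzc : z ≠ c := fun h => lt_irrefl c (h ▸ hcz); have hxz : x ≠ z := fun h => haz (h ▸ hax)
  have hbS : b ∉ S := fun h => hbD (hSD h)
  have hxS : x ∉ S := fun h => hxD (hSD h)
  have hzS : z ∉ S := fun h => hzD (hSD h)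
  -- ### junk sets and encodings of a colouring
  set Jx : Finset E := (down x).filter (fun d => d ≠ a ∧ d ≠ b) with hJx
  set Jz : Finset E := (down z).filter (fun d => d ≠ b ∧ d ≠ c) with hJz
  set DJ : Finset E := D.filter (fun d => d ≠ a ∧ d ≠ c) with hDJ          -- D ∖ {a, c} ⊇ S : the true junk of the virtual top
  set JZ : Finset E := D.filter (fun d => d ∉ S ∧ d ≠ a ∧ d ≠ c) with hJZ  -- D ∖ (S ∪ {a, c})
  set κ : (E → Bool) → ℕ := fun s => enc6 (s a) (s b) (s c) (s x) (cy s) (s z) with hκ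
  set pat : (E → Bool) → Finset E → Bool → Bool := fun s J v => decide (∀ d ∈ J, s d = v) with hpat
  set ρ : (E → Bool) → ℕ := fun s => enc6 (pat s Jx true) (pat s Jx false) (pat s DJ true) (pat s DJ false) (pat s Jz true) (pat s Jz false) with hρ
  set ρA : (E → Bool) → ℕ := fun s => enc6 (pat s Jx true) (pat s Jx false) (pat s JZ true) (pat s JZ false) (pat s Jz true) (pat s Jz false) with hρA
  set ρC : (E → Bool) → ℕ := fun s => enc6 (pat s Jx true) (pat s Jx false) false false (pat s Jz true) (pat s Jz false) with hρC
  set unif : (E → Bool) → Prop := fun s => (∀ e ∈ S, s e = true) ∨ (∀ e ∈ S, s e = false) with hunif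
  set ρh : (E → Bool) → ℕ := fun s => if unif s then ρA s else ρC s with hρh
  set code : (E → Bool) → ℕ := fun s => τ (κ s) (ρ s) with hcode
  set cpl : (E → Bool) → (E → Bool) := fun s => fun e => !s e with hcpl
  have hcplcpl : ∀ s, cpl (cpl s) = s := by intro s; funext e; simp [hcpl]
  -- ### labels
  have hlabC_lt : ∀ own p q rj bj, labC own p q rj bj < 4 := AntitheticCrownBridge.lab_lt labC hlabC
  have hlab_lt : ∀ s e, lab s e < 4 := by intro s e; rw [hlab]; split_ifs <;> omega
  have hly_lt : ∀ s, ly s < 4 := by intro s; rw [hly]; split_ifs <;> omega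
  have hlab_atom : ∀ s e, (∀ d, ¬ d < e) → lab s e = if s e = true then 0 else 3 := by
    intro s e he; rw [hlab, if_pos (fun d hd => (he d ((hdown d e).1 hd)).elim), if_pos (fun d hd => (he d ((hdown d e).1 hd)).elim)]
  have hlab_gen := AntitheticVirtualCrownTools.lab_split (E := E) labC hlabC
  have hlx : ∀ s, lab s x = labC (s x) (s a) (s b) (pat s Jx true) (pat s Jx false) := by
    intro s; rw [← hlab_gen (down x) (s x) a b Jx ((hdown a x).2 hax) ((hdown b x).2 hbx) hJx s, hlab]
  have hlz : ∀ s, lab s z = labC (s z) (s b) (s c) (pat s Jz true) (pat s Jz false) := by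
    intro s; rw [← hlab_gen (down z) (s z) b c Jz ((hdown b z).2 hbz) ((hdown c z).2 hcz) hJz s, hlab]
  have hlyC : ∀ s, ly s = labC (cy s) (s a) (s c) (pat s DJ true) (pat s DJ false) := by
    intro s; rw [← hlab_gen D (cy s) a c DJ haD hcD hDJ s, hly]
  have hla : ∀ s, lab s a = if s a = true then 0 else 3 := fun s => hlab_atom s a ha
  have hlb : ∀ s, lab s b = if s b = true then 0 else 3 := fun s => hlab_atom s b hb
  have hlc : ∀ s, lab s c = if s c = true then 0 else 3 := fun s => hlab_atom s c hc
  -- ### bits of the encodings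
  have hbits := AntitheticCrownBridge.enc6_testBit enc6 henc
  have hκbits : ∀ s, (κ s).testBit 0 = s a ∧ (κ s).testBit 1 = s b ∧ (κ s).testBit 2 = s c ∧ (κ s).testBit 3 = s x ∧
      (κ s).testBit 4 = cy s ∧ (κ s).testBit 5 = s z ∧ κ s < 64 := fun s => hbits (s a) (s b) (s c) (s x) (cy s) (s z)
  -- the code with an arbitrary pattern
  have hτκ : ∀ s (r0 b0 r1 b1 r2 b2 : Bool), τ (κ s) (enc6 r0 b0 r1 b1 r2 b2) =
      lab s a + 4 * lab s b + 16 * lab s c + 64 * labC (s x) (s a) (s b) r0 b0 + 256 * labC (cy s) (s a) (s c) r1 b1 +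
      1024 * labC (s z) (s b) (s c) r2 b2 := by
    intro s r0 b0 r1 b1 r2 b2
    obtain ⟨k0, k1, k2, k3, k4, k5, -⟩ := hκbits s; obtain ⟨e0, e1, e2, e3, e4, e5, -⟩ := hbits r0 b0 r1 b1 r2 b2
    rw [hτ]; dsimp only
    rw [k0, k1, k2, k3, k4, k5, e0, e1, e2, e3, e4, e5, hla s, hlb s, hlc s]
  have hcode_eq : ∀ s, code s = lab s a + 4 * lab s b + 16 * lab s c + 64 * lab s x + 256 * ly s + 1024 * lab s z := by
    intro s
    have : code s = τ (κ s) (ρ s) := rfl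
    rw [this, hρ]; dsimp only
    rw [hτκ, ← hlx s, ← hlz s, ← hlyC s]
  have hcode_lt : ∀ s, code s < 4096 := by
    intro s; rw [hcode_eq s]
    exact AntitheticCrownBridge.sum_lt_4096 (hlab_lt s a) (hlab_lt s b) (hlab_lt s c) (hlab_lt s x) (hly_lt s) (hlab_lt s z)
  have hdig : ∀ s, ((code s >>> (2 * 0)) &&& 3 = lab s a) ∧ ((code s >>> (2 * 1)) &&& 3 = lab s b) ∧ ((code s >>> (2 * 2)) &&& 3 = lab s c) ∧
      ((code s >>> (2 * 3)) &&& 3 = lab s x) ∧ ((code s >>> (2 * 4)) &&& 3 = ly s) ∧ ((code s >>> (2 * 5)) &&& 3 = lab s z) := by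
    intro s
    rw [hcode_eq s]
    exact AntitheticCrownBridge.digit_of_sum ⟨lab s a, hlab_lt s a⟩ ⟨lab s b, hlab_lt s b⟩ ⟨lab s c, hlab_lt s c⟩
      ⟨lab s x, hlab_lt s x⟩ ⟨ly s, hly_lt s⟩ ⟨lab s z, hlab_lt s z⟩
  -- ### le6 and monotonicity of the pulled-back sets
  have hle6_iff : ∀ u v, le6 u v = true ↔ ∀ i, i < 6 → leL ((u >>> (2 * i)) &&& 3) ((v >>> (2 * i)) &&& 3) = true := by
    intro u v; rw [hle6]; simp [List.all_eq_true, List.mem_range]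
  have hdigit_lt : ∀ (u i : ℕ), (u >>> (2 * i)) &&& 3 < 4 := by
    intro u i; have := @Nat.and_le_right (u >>> (2 * i)) 3; omega
  have hle6_code : ∀ s t, le s t → le6 (code s) (code t) = true := by
    intro s t hst
    have hst' := hst
    rw [hle] at hst; rw [hle6_iff]; intro i hi
    obtain ⟨d0, d1, d2, d3, d4, d5⟩ := hdig s; obtain ⟨e0, e1, e2, e3, e4, e5⟩ := hdig t
    interval_cases i
    exacts [by rw [d0, e0]; exact hst a, by rw [d1, e1]; exact hst b, by rw [d2, e2]; exact hst c,
      by rw [d3, e3]; exact hst x, by rw [d4, e4]; exact hmono s t hst', by rw [d5, e5]; exact hst z]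
  have hle6_trans : ∀ m u v, le6 m u = true → le6 u v = true → le6 m v = true := by
    intro m u v h1 h2; rw [hle6_iff] at h1 h2 ⊢; intro i hi
    exact AntitheticCrownBridge.leL_trans leL hleL (hdigit_lt m i) (hdigit_lt u i) (hdigit_lt v i) (h1 i hi) (h2 i hi)
  have hft_mono : ∀ s t, le s t → ft (code s) = true → ft (code t) = true := by
    intro s t hst hs
    have e1 := htabf ⟨code s, hcode_lt s⟩; have e2 := htabf ⟨code t, hcode_lt t⟩
    simp only at e1 e2; rw [e1, hfU] at hs; rw [e2, hfU]; simp only [List.any_eq_true] at hs ⊢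
    obtain ⟨m, hm, hml⟩ := hs; exact ⟨m, hm, hle6_trans m _ _ hml (hle6_code s t hst)⟩
  have hgt_mono : ∀ s t, le s t → gt (code s) = true → gt (code t) = true := by
    intro s t hst hs
    have e1 := htabg ⟨code s, hcode_lt s⟩; have e2 := htabg ⟨code t, hcode_lt t⟩
    simp only at e1 e2; rw [e1, hgH] at hs; rw [e2, hgH]; simp only [List.any_eq_true] at hs ⊢
    obtain ⟨m, hm, hml⟩ := hs; exact ⟨m, hm, hle6_trans m _ _ hml (hle6_code s t hst)⟩
  -- ### the two up-sets
  refine ⟨Finset.univ.filter (fun s => ft (code s) = true), Finset.univ.filter (fun s => gt (code s) = true), ?_, ?_, ?_⟩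
  · intro s t hst hs; simp only [Finset.mem_filter, Finset.mem_univ, true_and] at hs ⊢; exact hft_mono s t hst hs
  · intro s t hst hs; simp only [Finset.mem_filter, Finset.mem_univ, true_and] at hs ⊢; exact hgt_mono s t hst hs
  set U : Finset (E → Bool) := Finset.univ.filter (fun s => ft (code s) = true) with hU
  set H : Finset (E → Bool) := Finset.univ.filter (fun s => gt (code s) = true) with hH
  have hmem_img : ∀ s, s ∈ H.image (fun s => fun e => !s e) ↔ gt (code (cpl s)) = true := by
    intro s
    constructor
    · intro h
      obtain ⟨t, ht, rfl⟩ := Finset.mem_image.1 h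
      have : cpl (fun e => !t e) = t := hcplcpl t
      rw [this]; simpa [hH] using ht
    · exact fun h => Finset.mem_image.2 ⟨cpl s, by simpa [hH] using h, hcplcpl s⟩
  have hUH : (U ∩ H) = Finset.univ.filter (fun s => ft (code s) = true ∧ gt (code s) = true) := by
    ext s; simp [hU, hH, Finset.mem_inter]
  have hUiH : (U ∩ H.image (fun s => fun e => !s e)) = Finset.univ.filter (fun s => ft (code s) = true ∧ gt (code (cpl s)) = true) := by
    ext s; rw [Finset.mem_inter, hmem_img s]; simp [hU]
  -- complement of a colouring in code
  have hκcpl : ∀ s, κ (cpl s) = 63 - κ s := by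
    intro s; have := AntitheticCrownBridge.enc6_compl enc6 henc (s a) (s b) (s c) (s x) (cy s) (s z)
    show enc6 _ _ _ _ (cy (fun e => !s e)) _ = 63 - enc6 _ _ _ _ _ _; rw [hcyc s]; exact this
  have hsw6 := AntitheticCrownBridge.enc6_swap enc6 henc sw hsw
  have hpat_cpl : ∀ s (J : Finset E) (v : Bool), pat (cpl s) J v = pat s J (!v) := by
    intro s J v; rw [hpat]; dsimp only; congr 1; cases v <;> simp [hcpl]
  have hρcpl : ∀ s, ρ (cpl s) = sw (ρ s) := by
    intro s
    show enc6 _ _ _ _ _ _ = sw (enc6 _ _ _ _ _ _)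
    rw [hsw6, hpat_cpl, hpat_cpl, hpat_cpl, hpat_cpl, hpat_cpl, hpat_cpl]; rfl
  have hcode_cpl : ∀ s, code (cpl s) = 4095 - code s := by
    intro s
    have := AntitheticCrownBridge.tau_compl labC hlabC τ hτ sw hsw ⟨κ s, (hκbits s).2.2.2.2.2.2⟩ ⟨ρ s, (hbits _ _ _ _ _ _).2.2.2.2.2.2⟩
    simp only at this
    show τ (κ (cpl s)) (ρ (cpl s)) = 4095 - τ (κ s) (ρ s); rw [hκcpl, hρcpl, this]
  -- the summand
  set G : ℕ → ℕ → ℤ := fun k r => if ft (τ k r) = true then ((if gt (τ k r) = true then (1 : ℤ) else 0) - (if gt (4095 - τ k r) = true then (1 : ℤ) else 0))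
    else 0 with hG
  have hΔ : ((U ∩ H).card : ℤ) - ((U ∩ H.image (fun s => fun e => !s e)).card : ℤ) = ∑ s, G (κ s) (ρ s) := by
    rw [hUH, hUiH, Finset.card_filter, Finset.card_filter]
    push_cast
    rw [← Finset.sum_sub_distrib]
    refine Finset.sum_congr rfl (fun s _ => ?_)
    have ec : τ (κ s) (ρ s) = code s := rfl
    have e' : 4095 - code s = code (cpl s) := (hcode_cpl s).symm
    rw [hG]; dsimp only; rw [ec, e']
    by_cases h1 : ft (code s) = true <;> by_cases h2 : gt (code s) = true <;> by_cases h3 : gt (code (cpl s)) = true <;> simp [h1, h2, h3]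
  -- ### NEW: replace the true pattern ρ by the fibre-constant pattern ρh (same code)
  have hSDJ : ∀ e, e ∈ S → e ∈ DJ := by
    intro e he; rw [hDJ, Finset.mem_filter]; exact ⟨hSD he, fun h => haS (h ▸ he), fun h => hcS (h ▸ he)⟩
  have hDJ_iff : ∀ (s : E → Bool) (v : Bool), (∀ d ∈ DJ, s d = v) ↔ ((∀ d ∈ JZ, s d = v) ∧ (∀ e ∈ S, s e = v)) := by
    intro s v
    constructor
    · refine fun h => ⟨fun d hd => h d ?_, fun e he => h e (hSDJ e he)⟩
      rw [hJZ, Finset.mem_filter] at hd; rw [hDJ, Finset.mem_filter]; exact ⟨hd.1, hd.2.2⟩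
    · rintro ⟨h1, h2⟩ d hd
      by_cases hdS : d ∈ S
      · exact h2 d hdS
      · rw [hDJ, Finset.mem_filter] at hd; exact h1 d (by rw [hJZ, Finset.mem_filter]; exact ⟨hd.1, hdS, hd.2⟩)
  obtain ⟨e0, he0⟩ := hSne
  have hcy_of_red : ∀ s : E → Bool, (∀ e ∈ S, s e = true) → cy s = true := hcyr
  have hcy_of_blue : ∀ s : E → Bool, (∀ e ∈ S, s e = false) → cy s = false := by
    intro s hs
    have h1 : cy (cpl s) = true := hcyr (cpl s) (fun e he => by simp [hcpl, hs e he]); rw [hcyc] at h1; simpa using h1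
  have hGρ : ∀ s, G (κ s) (ρ s) = G (κ s) (ρh s) := by
    intro s
    -- it suffices that the codes agree
    suffices hτeq : τ (κ s) (ρ s) = τ (κ s) (ρh s) by rw [hG]; dsimp only; rw [hτeq]
    rw [hρh]; dsimp only
    by_cases hu : unif s
    · rw [if_pos hu, hρ, hρA]; dsimp only; rw [hτκ, hτκ]
      congr 2
      -- the virtual slot: labC (cy s) (s a) (s c) (pat DJ true) (pat DJ false) = labC (cy s) (s a) (s c) (pat JZ true) (pat JZ false)
      rcases hu with hr | hbl
      · have e1 : pat s DJ true = pat s JZ true := by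
          rw [hpat]; dsimp only; rw [decide_eq_decide]; rw [hDJ_iff]; exact ⟨fun h => h.1, fun h => ⟨h, hr⟩⟩
        rw [hcy_of_red s hr, e1, hlabC]; dsimp only; simp
      · have e1 : pat s DJ false = pat s JZ false := by
          rw [hpat]; dsimp only; rw [decide_eq_decide]; rw [hDJ_iff]; exact ⟨fun h => h.1, fun h => ⟨h, hbl⟩⟩
        rw [hcy_of_blue s hbl, e1, hlabC]; dsimp only; simp
    · rw [if_neg hu, hρ, hρC]; dsimp only
      have hu' : ¬ (∀ e ∈ S, s e = true) ∧ ¬ (∀ e ∈ S, s e = false) := by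
        simp only [hunif] at hu; exact not_or.mp hu
      have e1 : pat s DJ true = false := by rw [hpat]; dsimp only; rw [decide_eq_false_iff_not, hDJ_iff]; exact fun h => hu'.1 h.2
      have e2 : pat s DJ false = false := by rw [hpat]; dsimp only; rw [decide_eq_false_iff_not, hDJ_iff]; exact fun h => hu'.2 h.2
      rw [e1, e2]
  have hΔ1 : ∑ s, G (κ s) (ρ s) = ∑ s, G (κ s) (ρh s) := Finset.sum_congr rfl (fun s _ => hGρ s)
  -- ### fibrewise over the normalised colouring (tool `fibre_sum`)
  set five : Finset E := {a, b, c, x, z} with hfive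
  have hmem_five : ∀ e, e ∈ five ↔ e = a ∨ e = b ∨ e = c ∨ e = x ∨ e = z := by intro e; simp [hfive]
  have hfiveS : ∀ e ∈ five, e ∉ S := by
    intro e he; rw [hmem_five] at he; rcases he with rfl | rfl | rfl | rfl | rfl; exacts [haS, hbS, hcS, hxS, hzS]
  have hJ_off : ∀ d, (d ∈ Jx ∨ d ∈ JZ ∨ d ∈ Jz) → d ∉ five ∧ d ∉ S := by
    intro d hd
    have hzx : ¬ z < x := fun h => hcx (lt_trans hcz h)
    have hxz' : ¬ x < z := fun h => haz (lt_trans hax h)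
    rcases hd with hd | hd | hd
    · rw [hJx, Finset.mem_filter, hdown] at hd; obtain ⟨hd, hd1, hd2⟩ := hd
      refine ⟨fun hds => ?_, fun hdS => hSx d hdS hd⟩
      rw [hmem_five] at hds; rcases hds with rfl | rfl | rfl | rfl | rfl; exacts [hd1 rfl, hd2 rfl, hcx hd, lt_irrefl _ hd, hzx hd]
    · rw [hJZ, Finset.mem_filter] at hd; obtain ⟨hd, hdS, hd1, hd2⟩ := hd
      refine ⟨fun hds => ?_, hdS⟩
      rw [hmem_five] at hds; rcases hds with rfl | rfl | rfl | rfl | rfl; exacts [hd1 rfl, hbD hd, hd2 rfl, hxD hd, hzD hd]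
    · rw [hJz, Finset.mem_filter, hdown] at hd; obtain ⟨hd, hd1, hd2⟩ := hd
      refine ⟨fun hds => ?_, fun hdS => hSz d hdS hd⟩
      rw [hmem_five] at hds; rcases hds with rfl | rfl | rfl | rfl | rfl; exacts [haz hd, hd1 rfl, hd2 rfl, hxz' hd, lt_irrefl _ hd]
  have hpat_congr : ∀ (s t : E → Bool) (J : Finset E), (∀ d, d ∈ J → d ∉ five ∧ d ∉ S) → (∀ e, e ∉ five → e ∉ S → s e = t e) →
      ∀ v, pat s J v = pat t J v := by
    intro s t J hJ hst v; rw [hpat]; dsimp only; congr 1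
    exact propext ⟨fun h d hd => (hst d (hJ d hd).1 (hJ d hd).2) ▸ h d hd, fun h d hd => (hst d (hJ d hd).1 (hJ d hd).2).symm ▸ h d hd⟩
  have hρh_congr : ∀ s t : E → Bool, (∀ e, e ∉ five → e ∉ S → s e = t e) → (unif s ↔ unif t) → ρh s = ρh t := by
    intro s t hst hu
    have e1 := hpat_congr s t Jx (fun d hd => hJ_off d (Or.inl hd)) hst
    have e2 := hpat_congr s t JZ (fun d hd => hJ_off d (Or.inr (Or.inl hd))) hst
    have e3 := hpat_congr s t Jz (fun d hd => hJ_off d (Or.inr (Or.inr hd))) hst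
    rw [hρh]; dsimp only; rw [if_congr hu rfl rfl]
    by_cases hut : unif t
    · rw [if_pos hut, if_pos hut]; show enc6 _ _ _ _ _ _ = enc6 _ _ _ _ _ _; rw [e1, e1, e2, e2, e3, e3]
    · rw [if_neg hut, if_neg hut]; show enc6 _ _ _ _ _ _ = enc6 _ _ _ _ _ _; rw [e1, e1, e3, e3]
  set JS : Finset (E → Bool) := Finset.univ.filter (fun j => (∀ e ∈ five, j e = true) ∧
      ((∀ e ∈ S, j e = true) ∨ (¬ ((∀ e ∈ S, j e = true) ∨ (∀ e ∈ S, j e = false)) ∧ cy j = true))) with hJS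
  have hfib := AntitheticVirtualCrownTools.fibre_sum enc6 henc a b c x z hab hac hxa.symm hza.symm hbc hxb.symm hzb.symm hxc.symm hzc.symm hxz
    five S hfive hfiveS ⟨e0, he0⟩ cy hcyS hcyc hcyr JS hJS ρh (fun s t h1 h2 => hρh_congr s t h1 h2) G
  have hDsum : ∀ r, Dc r = ∑ k ∈ Finset.range 64, G k r := by
    intro r; rw [hDc, Finset.sum_eq_multiset_sum, Finset.range_val, ← Multiset.coe_range, Multiset.map_coe, Multiset.sum_coe]
  have hΔ2 : ∑ s, G (κ s) (ρh s) = ∑ j ∈ JS, Dc (ρh j) := by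
    rw [hfib]; exact Finset.sum_congr rfl (fun j _ => (hDsum _).symm)
  -- ### pairing j with its complement OFF the five and S
  set cj : (E → Bool) → (E → Bool) := fun j => fun e => if e ∈ five ∨ e ∈ S then j e else !j e with hcj
  have hcj_mem : ∀ j ∈ JS, cj j ∈ JS := by
    intro j hj
    rw [hJS, Finset.mem_filter] at hj ⊢
    obtain ⟨-, h5, hS⟩ := hj
    have hS_same : ∀ e ∈ S, cj j e = j e := fun e he => by simp [hcj, he]
    refine ⟨Finset.mem_univ _, fun e he => by simp [hcj, he, h5 e he], ?_⟩
    rcases hS with h | ⟨hmix, hc⟩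
    · exact Or.inl (fun e he => by rw [hS_same e he, h e he])
    · refine Or.inr ⟨fun hu => hmix ?_, by rw [hcyS (cj j) j hS_same, hc]⟩
      rcases hu with hu | hu
      exacts [Or.inl (fun e he => by rw [← hS_same e he, hu e he]), Or.inr (fun e he => by rw [← hS_same e he, hu e he])]
  have hcj_inv : ∀ j ∈ JS, cj (cj j) = j := by
    intro j _; funext e; by_cases he : e ∈ five ∨ e ∈ S <;> simp [hcj, he]
  have hunif_cj : ∀ j, unif (cj j) ↔ unif j := by
    intro j
    have hS_same : ∀ e ∈ S, cj j e = j e := fun e he => by simp [hcj, he]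
    rw [hunif]; dsimp only
    constructor
    · rintro (h | h); exacts [Or.inl (fun e he => by rw [← hS_same e he, h e he]), Or.inr (fun e he => by rw [← hS_same e he, h e he])]
    · rintro (h | h); exacts [Or.inl (fun e he => by rw [hS_same e he, h e he]), Or.inr (fun e he => by rw [hS_same e he, h e he])]
  have hpat_cj : ∀ (j : E → Bool) (J : Finset E), (∀ d, d ∈ J → d ∉ five ∧ d ∉ S) → ∀ v, pat (cj j) J v = pat j J (!v) := by
    intro j J hJ v; rw [hpat]; dsimp only; congr 1
    have hoff : ∀ d ∈ J, cj j d = !j d := fun d hd => by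
      have := hJ d hd; simp [hcj, this.1, this.2]
    exact propext ⟨fun h d hd => by have h1 := h d hd; rw [hoff d hd] at h1; revert h1; cases j d <;> cases v <;> simp,
      fun h d hd => by rw [hoff d hd, h d hd]; cases v <;> rfl⟩
  have hρh_cj : ∀ j, ρh (cj j) = sw (ρh j) := by
    intro j
    have e1 := hpat_cj j Jx (fun d hd => hJ_off d (Or.inl hd))
    have e2 := hpat_cj j JZ (fun d hd => hJ_off d (Or.inr (Or.inl hd)))
    have e3 := hpat_cj j Jz (fun d hd => hJ_off d (Or.inr (Or.inr hd)))
    rw [hρh]; dsimp only; rw [if_congr (hunif_cj j) rfl rfl]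
    by_cases hu : unif j
    · rw [if_pos hu, if_pos hu]; show enc6 _ _ _ _ _ _ = sw (enc6 _ _ _ _ _ _); rw [hsw6, e1, e1, e2, e2, e3, e3]; rfl
    · rw [if_neg hu, if_neg hu]; show enc6 _ _ _ _ _ _ = sw (enc6 _ _ _ _ _ _); rw [hsw6, e1, e1, e3, e3]; rfl
  have hpair : ∑ j ∈ JS, Dc (ρh j) = ∑ j ∈ JS, Dc (sw (ρh j)) := by
    have h1 : ∑ j ∈ JS, Dc (ρh j) = ∑ j ∈ JS, Dc (ρh (cj j)) :=
      Finset.sum_nbij' cj cj hcj_mem hcj_mem hcj_inv hcj_inv (fun j hj => by rw [hcj_inv j hj])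
    rw [h1]
    exact Finset.sum_congr rfl (fun j _ => by rw [hρh_cj])
  have htwice : 2 * ∑ j ∈ JS, Dc (ρh j) = ∑ j ∈ JS, (Dc (ρh j) + Dc (sw (ρh j))) := by
    rw [two_mul, Finset.sum_add_distrib, ← hpair]
  -- ### the certificate bounds
  have hρh_lt : ∀ j, ρh j < 64 := by
    intro j; rw [hρh]; dsimp only; split_ifs <;> exact (hbits _ _ _ _ _ _).2.2.2.2.2.2
  have hterm_nonpos : ∀ j, Dc (ρh j) + Dc (sw (ρh j)) ≤ 0 := fun j => by simpa using hnonpos ⟨ρh j, hρh_lt j⟩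
  set j0 : E → Bool := fun _ => true with hj0
  have hj0_mem : j0 ∈ JS := by rw [hJS, Finset.mem_filter]; exact ⟨Finset.mem_univ _, fun e _ => rfl, Or.inl (fun e _ => rfl)⟩
  have hρj0 : ρh j0 &&& 21 = 21 := by
    have hu : unif j0 := by rw [hunif]; exact Or.inl (fun e _ => rfl)
    have e1 : ∀ J : Finset E, pat j0 J true = true := by intro J; rw [hpat]; dsimp only; simp [hj0]
    rw [hρh]; dsimp only; rw [if_pos hu]
    show enc6 _ _ _ _ _ _ &&& 21 = 21; rw [e1, e1, e1]; exact AntitheticCrownBridge.enc6_and21 enc6 henc _ _ _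
  have hterm_strict : Dc (ρh j0) + Dc (sw (ρh j0)) ≤ -1 := by simpa using hstrict ⟨ρh j0, hρh_lt j0⟩ hρj0
  have hsum_le : ∑ j ∈ JS, (Dc (ρh j) + Dc (sw (ρh j))) ≤ -1 := by
    rw [← Finset.add_sum_erase JS _ hj0_mem]
    have : ∑ j ∈ JS.erase j0, (Dc (ρh j) + Dc (sw (ρh j))) ≤ 0 := Finset.sum_nonpos (fun j _ => hterm_nonpos j)
    linarith
  -- ### conclusion
  have hfinal : ((U ∩ H).card : ℤ) - ((U ∩ H.image (fun s => fun e => !s e)).card : ℤ) ≤ -1 := by rw [hΔ, hΔ1, hΔ2]; linarith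
  have : ((U ∩ H).card : ℤ) < ((U ∩ H.image (fun s => fun e => !s e)).card : ℤ) := by linarith
  exact_mod_cast this

end AntitheticVirtualCrown

end Summit.CriticalPhenomena.PercolationContinuityZ3.Theorems
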